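import Literature.NumberTheory.Sieve.DrappeauDispersionOrthogonality
import Literature.NumberTheory.Sieve.LargeSieveConductorTail
import Literature.NumberTheory.Sieve.BombieriAsymptoticSieveShiftedPrimes
import HarnessLib

/-!
# Drappeau 2017, §5.6: tools for the bound on the main terms `X₁ − X₃` — proved

S. Drappeau, *Sums of Kloosterman sums in arithmetic progressions, and the error term in the
dispersion method*, Proc. London Math. Soc. (3) 114 (2017) 684–732 = arXiv:1504.05549
(`Drappeau2017`; held as `paper:arxiv-1504.05549`, §5.6 read on chunk 21).

Elementary inputs for the bound `X₁ − X₃ ≪ (log x)^{O(1)} (N + N² R⁻²)` of §5.6 (the assembly is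
in `…DrappeauDispersionMainTerms`):

* `inv_lcm_mul_totient_gcd_le` — the weight of (5.16)/(5.21):
  `1/([q₁,q₂] φ((q₁,q₂))) ≤ (1 + log L)²/(q₁ q₂)` for `1 ≤ qⱼ ≤ L` (from the tree's
  `natCast_div_totient_le`, `d/φ(d) ≤ (1 + log d)²`; the source quotes `φ(q) ≫ q/log log q` from
  [Tenenbaum]).
* `sum_filter_dvd_inv_le` — "The sum over `q₁, q₂` is `O(1/(r² d₁ d₂))`": for `𝒬 ⊆ [1, L]` and
  `m ≥ 1`, `∑_{q ∈ 𝒬, m ∣ q} 1/q ≤ (1 + log L)/m` (harmonic sum).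
* `sum_filter_coprime_mul_eq` — "We can assume `(dⱼ, cond χ) = 1` because of the factors `χ(nⱼ)`":
  a character sum of `ψ mod f` over `n` coprime to `f k` equals the one over `n` coprime to `k`.
* `largeSieve_tail_filter_conj`, `largeSieve_tail_filter_inv` — the large sieve over conductors
  `> R` (`LargeSieve.largeSieve_character_tail`) for the sequence `β̄_n` (resp. with `ψ(n)⁻¹ = ψ̄(n)`)
  restricted to a sub-finset of `(M₀, M₀ + N]`:
  `∑_{R<f≤L} f⁻² ∑*_ψ |∑_{n ∈ 𝒩, P(n)} β̄_n ψ(n)|² ≤ (2(N+1)/R² + 6 + 4 log L) ∑_{n ∈ 𝒩} |β_n|²`.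

## References

* S. Drappeau, Proc. London Math. Soc. (3) 114 (2017) 684–732, arXiv:1504.05549, §5.6. [Drappeau2017]
-/

noncomputable section

open Finset DirichletCharacter

namespace Literature.NumberTheory.Sieve

namespace Drappeau2017

/-! ### The weight `1/([q₁,q₂] φ((q₁,q₂)))` -/

/-- `1/([q₁,q₂] φ((q₁,q₂))) ≤ (1 + log L)²/(q₁q₂)` for `1 ≤ q₁, q₂ ≤ L`
(`[q₁,q₂]·(q₁,q₂) = q₁q₂` and `(q₁,q₂)/φ((q₁,q₂)) ≤ (1 + log (q₁,q₂))² ≤ (1 + log L)²`).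
[cite: Drappeau2017, §5.6] -/
theorem inv_lcm_mul_totient_gcd_le {q₁ q₂ L : ℕ} (h₁ : 1 ≤ q₁) (h₁L : q₁ ≤ L) (h₂ : 1 ≤ q₂) :
    ((Nat.lcm q₁ q₂ : ℝ) * (Nat.totient (Nat.gcd q₁ q₂) : ℝ))⁻¹ ≤
      (1 + Real.log L) ^ 2 / ((q₁ : ℝ) * q₂) := by
  set g := Nat.gcd q₁ q₂ with hg
  have hg1 : 1 ≤ g := Nat.gcd_pos_of_pos_left _ h₁
  have hgL : g ≤ L := (Nat.gcd_le_left q₂ h₁).trans h₁L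
  have hφ : (0 : ℝ) < Nat.totient g := by exact_mod_cast Nat.totient_pos.2 hg1
  have hg0 : (0 : ℝ) < g := by exact_mod_cast hg1
  have hlcm0 : (0 : ℝ) < Nat.lcm q₁ q₂ := by exact_mod_cast Nat.lcm_pos h₁ h₂
  have hprod : ((Nat.lcm q₁ q₂ : ℝ)) * g = (q₁ : ℝ) * q₂ := by
    rw [mul_comm]; exact_mod_cast Nat.gcd_mul_lcm q₁ q₂
  -- `1/φ(g) ≤ (1 + log g)²/g ≤ (1 + log L)²/g`
  have hdiv : (g : ℝ) / Nat.totient g ≤ (1 + Real.log L) ^ 2 := by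
    refine (natCast_div_totient_le g).trans ?_
    have hlog0 : 0 ≤ Real.log g := Real.log_natCast_nonneg g
    have hlogle : Real.log g ≤ Real.log L :=
      Real.log_le_log hg0 (by exact_mod_cast hgL)
    nlinarith
  rw [div_le_iff₀ hφ] at hdiv
  rw [inv_eq_one_div, div_le_div_iff₀ (mul_pos hlcm0 hφ) (by positivity), one_mul, ← hprod]
  calc ((Nat.lcm q₁ q₂ : ℝ)) * g = (Nat.lcm q₁ q₂ : ℝ) * ((g : ℝ)) := rfl
    _ ≤ (Nat.lcm q₁ q₂ : ℝ) * ((1 + Real.log L) ^ 2 * Nat.totient g) :=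
        mul_le_mul_of_nonneg_left hdiv hlcm0.le
    _ = (1 + Real.log L) ^ 2 * ((Nat.lcm q₁ q₂ : ℝ) * Nat.totient g) := by ring

/-! ### `∑_{q ∈ 𝒬, m ∣ q} 1/q` -/

/-- For `𝒬 ⊆ [1, L]` and `m ≥ 1`: `∑_{q ∈ 𝒬, m ∣ q} 1/q ≤ (1 + log L)/m` (write `q = mk`, `k ≤ L/m`,
and bound the harmonic sum). [cite: Drappeau2017, §5.6] -/
theorem sum_filter_dvd_inv_le {𝒬 : Finset ℕ} {L m : ℕ} (h𝒬 : 𝒬 ⊆ Icc 1 L) (hm : 1 ≤ m) :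
    ∑ q ∈ 𝒬.filter (fun q => m ∣ q), ((q : ℝ))⁻¹ ≤ (1 + Real.log L) / m := by
  have hm0 : (0 : ℝ) < m := by exact_mod_cast hm
  -- `q = m k` with `k ∈ [1, L/m]`
  have hsub : 𝒬.filter (fun q => m ∣ q) ⊆ (Icc 1 (L / m)).image (fun k => m * k) := by
    intro q hq
    rw [Finset.mem_filter] at hq
    obtain ⟨k, rfl⟩ := hq.2
    have hqL := Finset.mem_Icc.1 (h𝒬 hq.1)
    refine Finset.mem_image.2 ⟨k, Finset.mem_Icc.2 ⟨?_, ?_⟩, rfl⟩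
    · rcases Nat.eq_zero_or_pos k with hk | hk
      · simp [hk] at hqL
      · exact hk
    · exact (Nat.le_div_iff_mul_le hm).2 (by rw [mul_comm]; exact hqL.2)
  have hinj : Set.InjOn (fun k => m * k) (Icc 1 (L / m) : Finset ℕ) :=
    fun a _ b _ h => Nat.eq_of_mul_eq_mul_left hm h
  calc ∑ q ∈ 𝒬.filter (fun q => m ∣ q), ((q : ℝ))⁻¹
      ≤ ∑ q ∈ (Icc 1 (L / m)).image (fun k => m * k), ((q : ℝ))⁻¹ :=
        Finset.sum_le_sum_of_subset_of_nonneg hsub fun q _ _ => by positivity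
    _ = ∑ k ∈ Icc 1 (L / m), ((m : ℝ))⁻¹ * ((k : ℝ))⁻¹ := by
        rw [Finset.sum_image hinj]
        refine Finset.sum_congr rfl fun k _ => ?_
        push_cast
        rw [mul_inv]
    _ = ((m : ℝ))⁻¹ * ((harmonic (L / m) : ℚ) : ℝ) := by
        rw [← Finset.mul_sum, harmonic_eq_sum_Icc]
        push_cast
        rfl
    _ ≤ ((m : ℝ))⁻¹ * (1 + Real.log L) := by
        refine mul_le_mul_of_nonneg_left ((harmonic_le_one_add_log _).trans ?_) (by positivity)
        have h0 : Real.log ((L / m : ℕ) : ℝ) ≤ Real.log L := by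
          rcases Nat.eq_zero_or_pos (L / m) with h | h
          · rw [h, Nat.cast_zero, Real.log_zero]; exact Real.log_natCast_nonneg L
          · exact Real.log_le_log (by exact_mod_cast h) (by exact_mod_cast Nat.div_le_self L m)
        linarith
    _ = (1 + Real.log L) / m := by rw [div_eq_inv_mul]

/-! ### Coprimality to the conductor is automatic -/

/-- For a character `ψ mod f` and weights `c`, the sum of `c_n ψ(n)⁻¹` over `n ∈ 𝒩` coprime to `f k`
equals the sum over `n ∈ 𝒩` coprime to `k`: the extra terms have `(n, f) > 1`, where `ψ(n) = 0`.
[cite: Drappeau2017, §5.6] -/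
theorem sum_filter_coprime_mul_inv_eq {f : ℕ} (ψ : DirichletCharacter ℂ f) (k : ℕ) (𝒩 : Finset ℕ)
    (c : ℕ → ℂ) :
    ∑ n ∈ 𝒩.filter (fun n => n.Coprime (f * k)), c n * (ψ (n : ZMod f))⁻¹ =
      ∑ n ∈ 𝒩.filter (fun n => n.Coprime k), c n * (ψ (n : ZMod f))⁻¹ := by
  refine Finset.sum_subset (fun n hn => ?_) (fun n hn hn' => ?_)
  · rw [Finset.mem_filter] at hn ⊢
    exact ⟨hn.1, Nat.Coprime.coprime_mul_left_right hn.2⟩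
  · rw [Finset.mem_filter] at hn hn'
    have hnf : ¬ n.Coprime f := fun h => hn' ⟨hn.1, Nat.Coprime.mul_right h hn.2⟩
    rw [MulChar.map_nonunit ψ (fun h => hnf ((ZMod.isUnit_iff_coprime n f).1 h)), inv_zero,
      mul_zero]

/-- The same for `c_n ψ(n)`. [cite: Drappeau2017, §5.6] -/
theorem sum_filter_coprime_mul_eq {f : ℕ} (ψ : DirichletCharacter ℂ f) (k : ℕ) (𝒩 : Finset ℕ)
    (c : ℕ → ℂ) :
    ∑ n ∈ 𝒩.filter (fun n => n.Coprime (f * k)), c n * ψ (n : ZMod f) =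
      ∑ n ∈ 𝒩.filter (fun n => n.Coprime k), c n * ψ (n : ZMod f) := by
  refine Finset.sum_subset (fun n hn => ?_) (fun n hn hn' => ?_)
  · rw [Finset.mem_filter] at hn ⊢
    exact ⟨hn.1, Nat.Coprime.coprime_mul_left_right hn.2⟩
  · rw [Finset.mem_filter] at hn hn'
    have hnf : ¬ n.Coprime f := fun h => hn' ⟨hn.1, Nat.Coprime.mul_right h hn.2⟩
    rw [MulChar.map_nonunit ψ (fun h => hnf ((ZMod.isUnit_iff_coprime n f).1 h)), mul_zero]

/-! ### The large sieve over conductors `> R` for restricted sequences -/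

open scoped Classical in
/-- **Large sieve tail for `β̄` on a sub-finset.**  For `𝒩 ⊆ (M₀, M₀ + N]`, any predicate `P` and
`1 ≤ R`:
`∑_{R < f ≤ L} f⁻² ∑_{ψ mod f primitive} |∑_{n ∈ 𝒩, P(n)} β̄_n ψ(n)|² ≤ (2(N+1)/R² + 6 + 4 log L) ∑_{n ∈ 𝒩} |β_n|²`.
[cite: Drappeau2017, Lemma 3.3 and §5.6] -/
theorem largeSieve_tail_filter_conj (β : ℕ → ℂ) (𝒩 : Finset ℕ) (P : ℕ → Prop) [DecidablePred P]
    {M₀ N R : ℕ} (L : ℕ) (hR : 1 ≤ R) (h𝒩 : 𝒩 ⊆ Ioc M₀ (M₀ + N)) :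
    ∑ f ∈ Ioc R L, (((f : ℝ)) ^ 2)⁻¹ *
        ∑ ψ : DirichletCharacter ℂ f with ψ.IsPrimitive,
          ‖∑ n ∈ 𝒩.filter P, starRingEnd ℂ (β n) * ψ (n : ZMod f)‖ ^ 2 ≤
      (2 * ((N : ℝ) + 1) / (R : ℝ) ^ 2 + 6 + 4 * Real.log L) * ∑ n ∈ 𝒩, ‖β n‖ ^ 2 := by
  classical
  -- extend `β̄ 1_P` by zero to `(M₀, M₀ + N]`
  set a : ℕ → ℂ := fun n => if n ∈ 𝒩.filter P then starRingEnd ℂ (β n) else 0 with ha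
  have hsum : ∀ (f : ℕ) (ψ : DirichletCharacter ℂ f),
      ∑ n ∈ 𝒩.filter P, starRingEnd ℂ (β n) * ψ (n : ZMod f) =
        ∑ n ∈ Ioc M₀ (M₀ + N), a n * ψ (n : ZMod f) := by
    intro f ψ
    rw [← Finset.sum_subset ((Finset.filter_subset P 𝒩).trans h𝒩)]
    · refine Finset.sum_congr rfl fun n hn => ?_
      simp only [ha, if_pos hn]
    · intro n _ hn
      simp only [ha, if_neg hn, zero_mul]
  have hnorm : ∑ n ∈ Ioc M₀ (M₀ + N), ‖a n‖ ^ 2 ≤ ∑ n ∈ 𝒩, ‖β n‖ ^ 2 := by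
    rw [← Finset.sum_subset ((Finset.filter_subset P 𝒩).trans h𝒩) (f := fun n => ‖a n‖ ^ 2)]
    · refine (Finset.sum_le_sum_of_subset_of_nonneg (Finset.filter_subset P 𝒩)
        (fun n _ _ => by positivity)).trans' (Finset.sum_le_sum fun n hn => ?_)
      simp only [ha, if_pos hn, Complex.norm_conj]
      exact le_rfl
    · intro n _ hn
      simp only [ha, if_neg hn, norm_zero]
      ring
  have hcoef : 0 ≤ 2 * ((N : ℝ) + 1) / (R : ℝ) ^ 2 + 6 + 4 * Real.log L := by
    have := Real.log_natCast_nonneg L; positivity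
  simp only [hsum]
  exact (LargeSieve.largeSieve_character_tail a M₀ N R L hR).trans
    (mul_le_mul_of_nonneg_left hnorm hcoef)

open scoped Classical in
/-- **Large sieve tail with `ψ(n)⁻¹`.**  Same bound for `|∑_{n ∈ 𝒩, P(n)} β_n ψ(n)⁻¹|²`
(`ψ(n)⁻¹ = ψ̄(n)`, so this is the conjugate of the previous sum).
[cite: Drappeau2017, Lemma 3.3 and §5.6] -/
theorem largeSieve_tail_filter_inv (β : ℕ → ℂ) (𝒩 : Finset ℕ) (P : ℕ → Prop) [DecidablePred P]
    {M₀ N R : ℕ} (L : ℕ) (hR : 1 ≤ R) (h𝒩 : 𝒩 ⊆ Ioc M₀ (M₀ + N)) :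
    ∑ f ∈ Ioc R L, (((f : ℝ)) ^ 2)⁻¹ *
        ∑ ψ : DirichletCharacter ℂ f with ψ.IsPrimitive,
          ‖∑ n ∈ 𝒩.filter P, β n * (ψ (n : ZMod f))⁻¹‖ ^ 2 ≤
      (2 * ((N : ℝ) + 1) / (R : ℝ) ^ 2 + 6 + 4 * Real.log L) * ∑ n ∈ 𝒩, ‖β n‖ ^ 2 := by
  have hconj : ∀ (f : ℕ) (ψ : DirichletCharacter ℂ f),
      ‖∑ n ∈ 𝒩.filter P, β n * (ψ (n : ZMod f))⁻¹‖ =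
        ‖∑ n ∈ 𝒩.filter P, starRingEnd ℂ (β n) * ψ (n : ZMod f)‖ := by
    intro f ψ
    rw [← Complex.norm_conj, map_sum]
    congr 1
    refine Finset.sum_congr rfl fun n _ => ?_
    rw [map_mul, map_inv₀, conj_apply_eq_inv, inv_inv]
  simp only [hconj]
  exact largeSieve_tail_filter_conj β 𝒩 P L hR h𝒩

end Drappeau2017

end Literature.NumberTheory.Sieve

end
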